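import Literature.Topology.FourManifolds.EuclideanRegularDomain
import Literature.Topology.FourManifolds.RegularDomainMaps
import Literature.Topology.FourManifolds.DiscFilling
import Literature.Topology.FourManifolds.CerfGammaFourProofs
import Literature.Topology.FourManifolds.HomotopySpheresBP

/-!
# The boundary of a compact regular domain `{F ≤ 0} ⊆ ℝ^{m+1}` is the embedded hypersurface
# `{F = 0}`: the cobordism `(D; ∅, N)` of a hypersurface `N ↪ ℝ^{m+1}` bounding `D`

Topic `Literature/Topology/FourManifolds`; continuation of `EuclideanRegularDomain.lean`
(infrastructure for the fact seat
`provefact-Literature.Geometry.Riemannian.LawsonMichelsohn1984_surrounding` and for the tree's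
statements in the level-set idiom).  Everything here is **proved**; no named fact is introduced.

In the level-set idiom a closed hypersurface is given twice: as a smooth embedding
`e : N → ℝ^{m+1}` of a compact boundaryless `m`-manifold, and as the regular zero set
`{F = 0} = range e` of the function `F` presenting the compact domain `D = {F ≤ 0}`
(`IsRegularCompactDomain F`).  This file identifies `N` with the boundary `∂D` of the
manifold with boundary `D` built in `EuclideanRegularDomain.lean`:

* `subtypeHomeomorph : {x // F x ≤ 0} ≃ₜ h.Domain` — the identity between the plain subtype of
  the level-set statements and `D`, carrying `{F = 0}` onto `∂D` and `{F < 0}` onto the interior;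
* `liftDomain`, `liftBoundary` — `e` lifted to `D` and to `∂D`; smooth (`contMDiff_liftDomain`,
  `contMDiff_liftBoundary`: Lee, *Introduction to Smooth Manifolds* (2013), Cor. 5.30, in the
  tree's forms `HalfSliceAtlas.contMDiff_codRestrict` and `BoundaryManifold.contMDiff_codRestrict`,
  `RegularDomainMaps.lean`), injective, and onto `∂D` when `range e = {F = 0}`;
* `boundaryHomeomorphOfRange : N ≃ₜ ∂D` (compact `N`, `e` continuous injective onto `{F = 0}`)
  and `boundaryDiffeomorph : N ≃ₘ ∂D` for a smooth embedding `e` of a compact `m`-manifold onto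
  `{F = 0}`, `m ≥ 1` — the inverse is smooth by the immersion criterion (Mathlib's
  `ContMDiff.iff_comp_isImmersion` for the immersion `e`: composed with `e` it is the smooth
  inclusion `∂D → ℝ^{m+1}`);
* `cobordismOfEmbedding : Cobordism m PEmpty N` — **the compact domain bounded by the
  hypersurface `e(N)` as the triad `(D; ∅, N)`** (Milnor, *Lectures on the h-cobordism
  theorem* (1965), Def. 1.1; the `D_f` of Lawson–Michelsohn, Invent. Math. 77 (1984), §6),
  the outgoing end `N ↪ D` being the boundary inclusion precomposed with the diffeomorphism
  (`Manifold.IsSmoothEmbedding.comp_diffeomorph`, `CerfGammaFourProofs.lean`);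
  `incl_cobordismOfEmbedding_inr : incl (inr p) = e p`, `range_cobordismOfEmbedding_inr`,
  and `joined_cobordismOfEmbedding_inr` (the hypothesis `H₀(D, N) = 0` of Milnor's Thm. 8.1
  Index 0 in the tree's form, for path-connected `D`).

With this, the Morse theory vendored for the tree's cobordisms (existence of Morse functions,
handle decompositions, Milnor's rearrangement / cancellation / trading theorems) applies to the
compact domain bounded by a closed hypersurface of Euclidean space.

## References

* J. M. Lee, *Introduction to Smooth Manifolds*, 2nd ed., GTM 218 (2013), Prop. 5.47,
  Thm. 5.11, Cor. 5.30. [LeeSmoothManifolds2013]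
* J. Milnor, *Lectures on the h-cobordism theorem*, Princeton (1965), Def. 1.1, Lemma 2.9.
  [MilnorHCobordism1965]
-/

open scoped Manifold ContDiff Topology
open Set Function

noncomputable section

namespace Literature.Topology.FourManifolds

/-- Local notation: `𝔼 n` is the model Euclidean space `EuclideanSpace ℝ (Fin n)`. -/
local notation "𝔼 " n:arg => EuclideanSpace ℝ (Fin n)

namespace IsRegularCompactDomain

open HalfSpaceCharted

variable {m : ℕ} {F : 𝔼 (m + 1) → ℝ} {N : Type} {e : N → 𝔼 (m + 1)}


/-! ### The plain subtype `{x // F x ≤ 0}` and the domain -/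

/-- **The identity between the subspace `{x // F x ≤ 0}` of `ℝ^{m+1}` and the domain `D`**
(the level-set statements of the tree quantify over the former; the manifold structure lives
on the latter). [folklore] -/
def subtypeHomeomorph (h : IsRegularCompactDomain F) :
    {x : 𝔼 (m + 1) // F x ≤ 0} ≃ₜ h.Domain where
  toFun p := Domain.mk h p.1 p.2
  invFun q := ⟨Domain.incl h q, Domain.apply_incl_nonpos h q⟩
  left_inv _ := rfl
  right_inv _ := rfl
  continuous_toFun := (Domain.isEmbedding_incl h).continuous_iff.2 continuous_subtype_val
  continuous_invFun := (Domain.continuous_incl h).subtype_mk _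

/-- The identity `{F ≤ 0} ≃ₜ D` followed by the inclusion `D → ℝ^{m+1}` is the subtype
inclusion (definitional). [folklore] -/
@[simp] theorem incl_subtypeHomeomorph (h : IsRegularCompactDomain F)
    (p : {x : 𝔼 (m + 1) // F x ≤ 0}) : Domain.incl h (h.subtypeHomeomorph p) = p.1 := rfl

/-- The inverse identity `D ≃ₜ {F ≤ 0}` is the inclusion on points (definitional). [folklore] -/
@[simp] theorem coe_subtypeHomeomorph_symm (h : IsRegularCompactDomain F) (q : h.Domain) :
    ((h.subtypeHomeomorph).symm q : 𝔼 (m + 1)) = Domain.incl h q := rfl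

/-- The identity `{F ≤ 0} ≃ₜ D` carries the zero set onto the boundary `∂D`. [folklore] -/
theorem image_subtypeHomeomorph (h : IsRegularCompactDomain F) :
    h.subtypeHomeomorph '' {p | F p.1 = 0} = (𝓡∂ (m + 1)).boundary h.Domain := by
  ext q
  constructor
  · rintro ⟨p, hp, rfl⟩
    exact (Domain.mem_boundary_iff h _).2 hp
  · intro hq
    exact ⟨h.subtypeHomeomorph.symm q, (Domain.mem_boundary_iff h q).1 hq,
      h.subtypeHomeomorph.apply_symm_apply q⟩

/-- The identity `{F ≤ 0} ≃ₜ D` carries `{F < 0}` onto the interior of `D`. [folklore] -/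
theorem image_subtypeHomeomorph_lt (h : IsRegularCompactDomain F) :
    h.subtypeHomeomorph '' {p | F p.1 < 0} = (𝓡∂ (m + 1)).interior h.Domain := by
  ext q
  constructor
  · rintro ⟨p, hp, rfl⟩
    exact (Domain.isInteriorPoint_iff h _).2 hp
  · intro hq
    exact ⟨h.subtypeHomeomorph.symm q, (Domain.isInteriorPoint_iff h q).1 hq,
      h.subtypeHomeomorph.apply_symm_apply q⟩

/-! ### Lifting the hypersurface to the boundary -/

/-- A map `e : N → ℝ^{m+1}` with values in the zero set, lifted to the domain `{F ≤ 0}`.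
[folklore] -/
def liftDomain (h : IsRegularCompactDomain F) (e : N → 𝔼 (m + 1))
    (hrange : range e ⊆ {x | F x = 0}) : N → h.Domain :=
  fun p => Domain.mk h (e p) (le_of_eq (hrange (mem_range_self p)))

/-- The lift composed with the inclusion is `e` (definitional). [folklore] -/
@[simp] theorem incl_liftDomain (h : IsRegularCompactDomain F) (hrange : range e ⊆ {x | F x = 0})
    (p : N) : Domain.incl h (h.liftDomain e hrange p) = e p := rfl

/-- The lift takes values in the boundary of the domain. [folklore] -/
theorem liftDomain_mem_boundary (h : IsRegularCompactDomain F) (hrange : range e ⊆ {x | F x = 0})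
    (p : N) : h.liftDomain e hrange p ∈ (𝓡∂ (m + 1)).boundary h.Domain :=
  (Domain.mem_boundary_iff h _).2 (hrange (mem_range_self p))

/-- The lift of `e` to the boundary manifold `∂D` of the domain. [folklore] -/
def liftBoundary (h : IsRegularCompactDomain F) (e : N → 𝔼 (m + 1))
    (hrange : range e ⊆ {x | F x = 0}) : N → (𝓡∂ (m + 1)).boundary h.Domain :=
  ((𝓡∂ (m + 1)).boundary h.Domain).codRestrict (h.liftDomain e hrange)
    (h.liftDomain_mem_boundary hrange)

/-- The boundary lift composed with the two inclusions is `e` (definitional). [folklore] -/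
@[simp] theorem incl_val_liftBoundary (h : IsRegularCompactDomain F)
    (hrange : range e ⊆ {x | F x = 0}) (p : N) :
    Domain.incl h (h.liftBoundary e hrange p).1 = e p := rfl

/-- The boundary lift followed by the inclusion `∂D → D` is the lift to the domain
(definitional). [folklore] -/
@[simp] theorem val_liftBoundary (h : IsRegularCompactDomain F)
    (hrange : range e ⊆ {x | F x = 0}) (p : N) :
    (h.liftBoundary e hrange p).1 = h.liftDomain e hrange p := rfl

/-- The boundary lift of an injective map is injective. [folklore] -/
theorem injective_liftBoundary (h : IsRegularCompactDomain F)
    (hrange : range e ⊆ {x | F x = 0}) (he : Injective e) :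
    Injective (h.liftBoundary e hrange) := fun p q hpq =>
  he (by simpa using congrArg (fun z => Domain.incl h z.1) hpq)

/-- The boundary lift of a map ONTO the zero set is surjective. [folklore] -/
theorem surjective_liftBoundary (h : IsRegularCompactDomain F)
    (hrange : range e = {x | F x = 0}) :
    Surjective (h.liftBoundary e hrange.le) := by
  intro q
  have hq : Domain.incl h q.1 ∈ range e := by
    rw [hrange]; exact (Domain.mem_boundary_iff h q.1).1 q.2
  obtain ⟨p, hp⟩ := hq
  refine ⟨p, Subtype.ext ((Domain.incl_inj h).1 ?_)⟩
  simpa using hp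

variable [TopologicalSpace N]

/-- The boundary lift is continuous when `e` is. [folklore] -/
theorem continuous_liftBoundary (h : IsRegularCompactDomain F)
    (hrange : range e ⊆ {x | F x = 0}) (he : Continuous e) :
    Continuous (h.liftBoundary e hrange) := by
  refine Continuous.codRestrict ?_ _
  exact (Domain.isEmbedding_incl h).continuous_iff.2 (by simpa [Function.comp_def] using he)

/-- **The boundary `∂D` of the domain is homeomorphic to any compact space embedded onto the
zero set**: for `e : N → ℝ^{m+1}` continuous and injective from a compact `N` with
`range e = {F = 0}`, the lift `N → ∂D` is a homeomorphism. [folklore] -/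
def boundaryHomeomorphOfRange [CompactSpace N] (h : IsRegularCompactDomain F)
    (hcont : Continuous e) (hinj : Injective e) (hrange : range e = {x | F x = 0}) :
    N ≃ₜ (𝓡∂ (m + 1)).boundary h.Domain :=
  (h.continuous_liftBoundary hrange.le hcont).homeoOfEquivCompactToT2
    (f := Equiv.ofBijective (h.liftBoundary e hrange.le)
      ⟨h.injective_liftBoundary hrange.le hinj, h.surjective_liftBoundary hrange⟩)

/-- The homeomorphism `N ≃ₜ ∂D` is the boundary lift on points. [folklore] -/
@[simp] theorem boundaryHomeomorphOfRange_apply [CompactSpace N] (h : IsRegularCompactDomain F)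
    (hcont : Continuous e) (hinj : Injective e) (hrange : range e = {x | F x = 0}) (p : N) :
    h.boundaryHomeomorphOfRange hcont hinj hrange p = h.liftBoundary e hrange.le p := rfl

variable [ChartedSpace (𝔼 m) N]

/-- **A smooth map into the zero set lifts smoothly to the domain** (a regular domain is an
embedded submanifold with boundary; Lee 2013, Cor. 5.30 with Prop. 5.47).
[cite: LeeSmoothManifolds2013, Cor. 5.30] -/
theorem contMDiff_liftDomain (h : IsRegularCompactDomain F) (hrange : range e ⊆ {x | F x = 0})
    (he : ContMDiff (𝓡 m) (𝓡 (m + 1)) ∞ e) :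
    ContMDiff (𝓡 m) (𝓡∂ (m + 1)) ∞ (h.liftDomain e hrange) := by
  have h1 : ContMDiff (𝓡 m) (𝓡∂ (m + 1)) ∞ ((of (X := 𝔼 (m + 1))) ∘ e) :=
    (contMDiff_of (n := m) (X := 𝔼 (m + 1))).comp he
  exact h.atlas.contMDiff_codRestrict (fun p => le_of_eq (hrange (mem_range_self p))) h1

/-- **A smooth map into the zero set lifts smoothly to the boundary manifold `∂D`**
(Lee 2013, Thm. 5.11 and Cor. 5.30). [cite: LeeSmoothManifolds2013, Cor. 5.30] -/
theorem contMDiff_liftBoundary (h : IsRegularCompactDomain F) (hrange : range e ⊆ {x | F x = 0})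
    (he : ContMDiff (𝓡 m) (𝓡 (m + 1)) ∞ e) :
    ContMDiff (𝓡 m) (𝓡 m) ∞ (h.liftBoundary e hrange) :=
  BoundaryManifold.contMDiff_codRestrict (h.liftDomain_mem_boundary hrange)
    (h.contMDiff_liftDomain hrange he)

/-- **The boundary `∂D` is diffeomorphic to any closed manifold smoothly embedded onto the zero
set** `{F = 0}`: for a smooth embedding `e : N → ℝ^{m+1}` of a compact `m`-manifold with
`range e = {F = 0}`, the lift `N → ∂D` is a diffeomorphism.  Smoothness of the lift is Lee's
Cor. 5.30 (maps into the embedded submanifolds `D` and `∂D`); smoothness of the inverse is the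
same principle for the immersion `e` (Mathlib's `ContMDiff.iff_comp_isImmersion`: the inverse
is continuous and becomes the smooth map `∂D → ℝ^{m+1}` after composition with `e`).
[cite: LeeSmoothManifolds2013, Cor. 5.30 and Prop. 5.47] -/
def boundaryDiffeomorph [CompactSpace N] [IsManifold (𝓡 m) ∞ N] (h : IsRegularCompactDomain F)
    (hm : 1 ≤ m) (he : Manifold.IsSmoothEmbedding (𝓡 m) (𝓡 (m + 1)) ∞ e)
    (hrange : range e = {x | F x = 0}) :
    N ≃ₘ⟮𝓡 m, 𝓡 m⟯ (𝓡∂ (m + 1)).boundary h.Domain where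
  toEquiv := (h.boundaryHomeomorphOfRange he.contMDiff.continuous he.isEmbedding.injective
    hrange).toEquiv
  contMDiff_toFun := h.contMDiff_liftBoundary hrange.le he.contMDiff
  contMDiff_invFun := by
    set Φ := h.boundaryHomeomorphOfRange he.contMDiff.continuous he.isEmbedding.injective hrange
      with hΦ
    change ContMDiff (𝓡 m) (𝓡 m) ∞ Φ.symm
    rw [ContMDiff.iff_comp_isImmersion he.isImmersion]
    refine ⟨Φ.symm.continuous, ?_⟩
    have hcomp : e ∘ Φ.symm = fun q : (𝓡∂ (m + 1)).boundary h.Domain => Domain.incl h q.1 := by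
      funext q
      show e (Φ.symm q) = Domain.incl h q.1
      have h1 : Domain.incl h (Φ (Φ.symm q)).1 = e (Φ.symm q) := rfl
      rw [← h1, Φ.apply_symm_apply]
    rw [hcomp]
    exact (Domain.contMDiff_incl h hm).comp
      (BoundaryManifold.isSmoothEmbedding_subtype_val (n := m) (W := h.Domain)).contMDiff

/-- The diffeomorphism `N ≃ₘ ∂D` is the boundary lift on points. [folklore] -/
@[simp] theorem boundaryDiffeomorph_apply [CompactSpace N] [IsManifold (𝓡 m) ∞ N]
    (h : IsRegularCompactDomain F) (hm : 1 ≤ m)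
    (he : Manifold.IsSmoothEmbedding (𝓡 m) (𝓡 (m + 1)) ∞ e)
    (hrange : range e = {x | F x = 0}) (p : N) :
    h.boundaryDiffeomorph hm he hrange p = h.liftBoundary e hrange.le p := rfl

/-- The diffeomorphism followed by the inclusions `∂D → D → ℝ^{m+1}` is `e`. [folklore] -/
@[simp] theorem incl_val_boundaryDiffeomorph [CompactSpace N] [IsManifold (𝓡 m) ∞ N]
    (h : IsRegularCompactDomain F) (hm : 1 ≤ m)
    (he : Manifold.IsSmoothEmbedding (𝓡 m) (𝓡 (m + 1)) ∞ e)
    (hrange : range e = {x | F x = 0}) (p : N) :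
    Domain.incl h (h.boundaryDiffeomorph hm he hrange p).1 = e p := rfl

/-- **The compact regular domain `{F ≤ 0}` as a cobordism from `∅` to `N`**, for a closed
`m`-manifold `N` smoothly embedded onto the zero set `{F = 0}` (`m ≥ 1`): total space the
domain, outgoing end `N` included by the lift of `e` — a smooth embedding, being the boundary
inclusion `∂D → D` precomposed with the diffeomorphism `N ≃ₘ ∂D`
(`Manifold.IsSmoothEmbedding.comp_diffeomorph`).  This is the triad `(D_f; ∅, N)` of a
hypersurface `f : N ↪ ℝ^{m+1}` bounding the compact domain `D_f` (Milnor 1965, Def. 1.1;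
Lawson–Michelsohn 1984, §6). [cite: MilnorHCobordism1965, Def. 1.1 with Lemma 2.9] -/
def cobordismOfEmbedding [CompactSpace N] [IsManifold (𝓡 m) ∞ N] (h : IsRegularCompactDomain F)
    (hm : 1 ≤ m) (he : Manifold.IsSmoothEmbedding (𝓡 m) (𝓡 (m + 1)) ∞ e)
    (hrange : range e = {x | F x = 0}) : Cobordism m PEmpty.{1} N where
  W := h.Domain
  inl := PEmpty.elim
  inr := h.liftDomain e hrange.le
  isSmoothEmbedding_inl :=
    ⟨⟨PUnit, inferInstance, inferInstance, fun x => x.elim⟩, .of_subsingleton _⟩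
  isSmoothEmbedding_inr :=
    (BoundaryManifold.isSmoothEmbedding_subtype_val (n := m) (W := h.Domain)).comp_diffeomorph
      (h.boundaryDiffeomorph hm he hrange)
  disjoint_range := by simp [Set.range_eq_empty]
  range_inl_union_range_inr := by
    rw [Set.range_eq_empty, empty_union]
    ext q
    constructor
    · rintro ⟨p, rfl⟩
      exact h.liftDomain_mem_boundary hrange.le p
    · intro hq
      obtain ⟨p, hp⟩ := h.surjective_liftBoundary hrange ⟨q, hq⟩
      exact ⟨p, congrArg Subtype.val hp⟩

/-- The total space of `(D; ∅, N)` is the domain (definitional). [folklore] -/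
@[simp] theorem cobordismOfEmbedding_W [CompactSpace N] [IsManifold (𝓡 m) ∞ N]
    (h : IsRegularCompactDomain F) (hm : 1 ≤ m)
    (he : Manifold.IsSmoothEmbedding (𝓡 m) (𝓡 (m + 1)) ∞ e)
    (hrange : range e = {x | F x = 0}) : (h.cobordismOfEmbedding hm he hrange).W = h.Domain :=
  rfl

/-- The outgoing end of `(D; ∅, N)` followed by the inclusion into `ℝ^{m+1}` is the given
embedding `e` (definitional). [folklore] -/
@[simp] theorem incl_cobordismOfEmbedding_inr [CompactSpace N] [IsManifold (𝓡 m) ∞ N]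
    (h : IsRegularCompactDomain F) (hm : 1 ≤ m)
    (he : Manifold.IsSmoothEmbedding (𝓡 m) (𝓡 (m + 1)) ∞ e)
    (hrange : range e = {x | F x = 0}) (p : N) :
    Domain.incl h ((h.cobordismOfEmbedding hm he hrange).inr p) = e p := rfl

/-- The outgoing end of `(D; ∅, N)` maps onto the boundary `{F = 0}` of the domain. [folklore] -/
theorem range_cobordismOfEmbedding_inr [CompactSpace N] [IsManifold (𝓡 m) ∞ N]
    (h : IsRegularCompactDomain F) (hm : 1 ≤ m)
    (he : Manifold.IsSmoothEmbedding (𝓡 m) (𝓡 (m + 1)) ∞ e)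
    (hrange : range e = {x | F x = 0}) :
    range (h.cobordismOfEmbedding hm he hrange).inr = (𝓡∂ (m + 1)).boundary h.Domain := by
  have := (h.cobordismOfEmbedding hm he hrange).range_inl_union_range_inr
  rwa [Set.range_eq_empty, empty_union] at this

/-- Every point of the connected domain is joined by a path to a point of the outgoing end, as
soon as `N` is nonempty: the hypothesis `H₀(D, N) = 0` of Milnor's cancellation of critical
points of index `0` (`Cobordism.Milnor1965_cancel_index_zero`, turned about). [folklore] -/
theorem joined_cobordismOfEmbedding_inr [CompactSpace N] [IsManifold (𝓡 m) ∞ N] [Nonempty N]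
    (h : IsRegularCompactDomain F) (hm : 1 ≤ m)
    (he : Manifold.IsSmoothEmbedding (𝓡 m) (𝓡 (m + 1)) ∞ e)
    (hrange : range e = {x | F x = 0}) [PathConnectedSpace h.Domain] (z : h.Domain) :
    ∃ x : N, Joined z ((h.cobordismOfEmbedding hm he hrange).inr x) :=
  ⟨Classical.arbitrary N, PathConnectedSpace.joined z _⟩

/-- **The compact domain bounded by the hypersurface `e(N)` as a null-cobordism of `N`**
(Kervaire–Milnor 1963, §1: "`M = bW`"; the tree's `NullCobordism`, `HomotopySpheresBP.lean`):
the same data as `cobordismOfEmbedding` with the empty end dropped — the form consumed by the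
tree's ball-removal construction `BallRemovalData.cobordism` (`BallRemovalCobordism.lean`),
which presents `D ∖ B̊` as a cobordism `(D ∖ B̊; N, 𝕊ᵐ)` for a ball `B` in the interior.
[cite: MilnorHCobordism1965, Def. 1.1 with Lemma 2.9] -/
def nullCobordismOfEmbedding [CompactSpace N] [IsManifold (𝓡 m) ∞ N]
    (h : IsRegularCompactDomain F) (hm : 1 ≤ m)
    (he : Manifold.IsSmoothEmbedding (𝓡 m) (𝓡 (m + 1)) ∞ e)
    (hrange : range e = {x | F x = 0}) : NullCobordism m N where
  W := h.Domain
  topologicalSpace := Domain.instTopologicalSpace h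
  t2Space := Domain.instT2Space h
  secondCountableTopology := Domain.instSecondCountableTopology h
  chartedSpace := Domain.instChartedSpace h
  isManifold := Domain.instIsManifold h
  compactSpace := Domain.instCompactSpace h
  incl := h.liftDomain e hrange.le
  isSmoothEmbedding_incl := (h.cobordismOfEmbedding hm he hrange).isSmoothEmbedding_inr
  range_incl := h.range_cobordismOfEmbedding_inr hm he hrange

/-- The bounding manifold of the null-cobordism is the domain (definitional). [folklore] -/
@[simp] theorem nullCobordismOfEmbedding_W [CompactSpace N] [IsManifold (𝓡 m) ∞ N]
    (h : IsRegularCompactDomain F) (hm : 1 ≤ m)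
    (he : Manifold.IsSmoothEmbedding (𝓡 m) (𝓡 (m + 1)) ∞ e)
    (hrange : range e = {x | F x = 0}) : (h.nullCobordismOfEmbedding hm he hrange).W = h.Domain :=
  rfl

/-- The boundary inclusion of the null-cobordism followed by the inclusion into `ℝ^{m+1}` is
`e` (definitional). [folklore] -/
@[simp] theorem incl_nullCobordismOfEmbedding_incl [CompactSpace N] [IsManifold (𝓡 m) ∞ N]
    (h : IsRegularCompactDomain F) (hm : 1 ≤ m)
    (he : Manifold.IsSmoothEmbedding (𝓡 m) (𝓡 (m + 1)) ∞ e)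
    (hrange : range e = {x | F x = 0}) (p : N) :
    Domain.incl h ((h.nullCobordismOfEmbedding hm he hrange).incl p) = e p := rfl

end IsRegularCompactDomain

end Literature.Topology.FourManifolds

end
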